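import Mathlib.Analysis.SpecialFunctions.SmoothTransition
import Mathlib.Analysis.Calculus.Deriv.Slope
import Mathlib.Analysis.Calculus.Deriv.Mul
import Mathlib.Analysis.Calculus.Deriv.Add
import Mathlib.Analysis.Calculus.Deriv.Comp
import Mathlib.Analysis.Calculus.ContDiff.Deriv
import Mathlib.Analysis.InnerProductSpace.Basic
import Mathlib.Topology.Order.Compact
import HarnessLib

/-!
# Pacing functions of the tube stage and the Euler-defect/transversality bridge

Topic `Literature/Topology/FourManifolds`; elementary real analysis serving the zone lemmas of the
codimension `≥ 2` tube stage (`TubeFlatten.lean`, `TubeConeify.lean`, `TubeRound.lean`,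
`TubeRadial.lean`; Munkres, Ann. of Math. 72 (1960), §§4–5; Campbell–D'Onofrio–Vítek, J. Geom.
Anal. (2026), §3).  Contents:

* `rampCutoff a b` — the smooth monotone cutoff `t ↦ smoothTransition ((t − a)/(b − a))`, `= 0` on
  `(−∞, a]`, `= 1` on `[b, ∞)`, values in `[0, 1]`, nonnegative derivative, and a derivative bound
  `|rampCutoff'| ≤ C/(b − a)` with a universal constant (`exists_deriv_smoothTransition_bound`).
* `conePacing a b r₁ t = r₁ + rampCutoff a b t · (t − r₁)` — the radius pacing of cone-ification:
  `≡ r₁` below `a`, `= t` above `b`, positive, with **bounded exponent** `|1 − t μ'/μ| ≤ K₀` for an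
  explicit `K₀` depending only on `b/r₁` and `b/(b − a)` (`abs_one_sub_exponent_conePacing_le`) —
  the hypothesis `hκ` of `injective_fderiv_coneifyStageMap`.
* `inner_pos_of_euler_defect_lt` — **a source-form Euler defect smaller than the radius implies
  radial transversality**: if `L u = L z − Nz ⟹ ‖u‖ < ‖z‖` for a linear `L` (the fibre derivative)
  then `L v = Nz ⟹ ⟪v, z⟫ > 0`; this converts the export of cone-ification into the hypothesis
  `htr` of `TubeLink.lean` / `TubeRound.lean`.

Everything is proved; no named facts.

## References

* J. R. Munkres, *Obstructions to the smoothing of piecewise-differentiable homeomorphisms*, Ann.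
  of Math. (2) 72 (1960), 521–554, §§4–5. [Munkres1960]
* D. Campbell, L. D'Onofrio, T. Vítek, *Diffeomorphic approximation of piecewise affine
  homeomorphisms*, J. Geom. Anal. 36 (2026), §3. [CampbellDonofrioVitek2026]
-/

noncomputable section

open Set Function Metric Filter Real
open scoped Topology ContDiff RealInnerProductSpace

namespace Literature.Topology.FourManifolds

/-! ### §1 The universal derivative bound of `smoothTransition` -/

/-- `smoothTransition` is differentiable with a **bounded, nonnegative derivative** vanishing off
`[0, 1]`: there is `C ≥ 0` with `0 ≤ deriv smoothTransition x ≤ C` for all `x`. [folklore] -/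
theorem exists_deriv_smoothTransition_bound :
    ∃ C : ℝ, 0 ≤ C ∧ ∀ x : ℝ, 0 ≤ deriv smoothTransition x ∧ deriv smoothTransition x ≤ C := by
  have hdiff : Differentiable ℝ smoothTransition :=
    (smoothTransition.contDiff (n := 1)).differentiable (by simp)
  have hcont : Continuous (deriv smoothTransition) :=
    (smoothTransition.contDiff (n := 1)).continuous_deriv le_rfl
  have hnonneg : ∀ x, 0 ≤ deriv smoothTransition x := fun x =>
    (hdiff x).hasDerivAt.nonneg_of_monotone smoothTransition.monotone
  obtain ⟨C, hC⟩ := isCompact_Icc.exists_bound_of_continuousOn (s := Icc (0 : ℝ) 1) hcont.continuousOn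
  have hC0 : 0 ≤ C := (norm_nonneg _).trans (hC 0 ⟨le_rfl, zero_le_one⟩)
  refine ⟨C, hC0, fun x => ⟨hnonneg x, ?_⟩⟩
  by_cases hx : x ∈ Icc (0 : ℝ) 1
  · exact (le_abs_self _).trans ((Real.norm_eq_abs _).symm.le.trans (hC x hx))
  · -- off `[0,1]` the function is locally constant, so the derivative vanishes
    have hzero : deriv smoothTransition x = 0 := by
      rw [mem_Icc, not_and_or, not_le, not_le] at hx
      rcases hx with hx | hx
      · have hev : smoothTransition =ᶠ[𝓝 x] fun _ => (0 : ℝ) := by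
          filter_upwards [Iio_mem_nhds hx] with y hy
          exact smoothTransition.zero_of_nonpos (le_of_lt hy)
        rw [hev.deriv_eq]; exact deriv_const x 0
      · have hev : smoothTransition =ᶠ[𝓝 x] fun _ => (1 : ℝ) := by
          filter_upwards [Ioi_mem_nhds hx] with y hy
          exact smoothTransition.one_of_one_le (le_of_lt hy)
        rw [hev.deriv_eq]; exact deriv_const x 1
    rw [hzero]; exact hC0

/-! ### §2 The ramp cutoff -/

/-- **The ramp cutoff** `rampCutoff a b t = smoothTransition ((t − a)/(b − a))`: smooth, monotone,
`= 0` for `t ≤ a`, `= 1` for `t ≥ b` (`a < b`). [folklore] -/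
def rampCutoff (a b t : ℝ) : ℝ :=
  smoothTransition ((t - a) / (b - a))

section RampCutoff

variable {a b : ℝ}

/-- Below `a` the ramp cutoff vanishes. [folklore] -/
theorem rampCutoff_of_le (hab : a < b) {t : ℝ} (ht : t ≤ a) : rampCutoff a b t = 0 :=
  smoothTransition.zero_of_nonpos (div_nonpos_of_nonpos_of_nonneg (by linarith) (by linarith))

/-- Above `b` the ramp cutoff is one. [folklore] -/
theorem rampCutoff_of_ge (hab : a < b) {t : ℝ} (ht : b ≤ t) : rampCutoff a b t = 1 :=
  smoothTransition.one_of_one_le ((one_le_div (by linarith)).2 (by linarith))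

/-- The ramp cutoff takes values in `[0, 1]`. [folklore] -/
theorem rampCutoff_mem_Icc (a b t : ℝ) : rampCutoff a b t ∈ Icc (0 : ℝ) 1 :=
  ⟨smoothTransition.nonneg _, smoothTransition.le_one _⟩

/-- `|rampCutoff| ≤ 1`. [folklore] -/
theorem abs_rampCutoff_le_one (a b t : ℝ) : |rampCutoff a b t| ≤ 1 := by
  rw [abs_of_nonneg (rampCutoff_mem_Icc a b t).1]; exact (rampCutoff_mem_Icc a b t).2

/-- The ramp cutoff is smooth. [folklore] -/
theorem contDiff_rampCutoff (a b : ℝ) : ContDiff ℝ ∞ (rampCutoff a b) :=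
  (smoothTransition.contDiff (n := ⊤)).comp ((contDiff_id.sub contDiff_const).div_const _)

/-- The ramp cutoff is monotone (`a < b`). [folklore] -/
theorem monotone_rampCutoff (hab : a < b) : Monotone (rampCutoff a b) := fun s t hst =>
  smoothTransition.monotone (div_le_div_of_nonneg_right (by linarith) (by linarith))

/-- **Derivative of the ramp cutoff**: `rampCutoff' t = smoothTransition'((t−a)/(b−a)) / (b − a)`.
[folklore] -/
theorem hasDerivAt_rampCutoff (t : ℝ) :
    HasDerivAt (rampCutoff a b) (deriv smoothTransition ((t - a) / (b - a)) / (b - a)) t := by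
  have hdiff : Differentiable ℝ smoothTransition :=
    (smoothTransition.contDiff (n := 1)).differentiable (by simp)
  have hin : HasDerivAt (fun s : ℝ => (s - a) / (b - a)) (1 / (b - a)) t := by
    have := ((hasDerivAt_id t).sub_const a).div_const (b - a)
    exact this
  have := (hdiff _).hasDerivAt.comp t hin
  rw [div_eq_mul_one_div]
  exact this

/-- **The ramp cutoff has nonnegative derivative bounded by `C/(b − a)`** with the universal
constant of `exists_deriv_smoothTransition_bound`. [folklore] -/
theorem exists_deriv_rampCutoff_bound (hab : a < b) :
    ∃ C : ℝ, 0 ≤ C ∧ ∀ t : ℝ, 0 ≤ deriv (rampCutoff a b) t ∧ deriv (rampCutoff a b) t ≤ C / (b - a) := by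
  obtain ⟨C, hC0, hC⟩ := exists_deriv_smoothTransition_bound
  refine ⟨C, hC0, fun t => ?_⟩
  rw [(hasDerivAt_rampCutoff t).deriv]
  have hba : 0 < b - a := by linarith
  exact ⟨div_nonneg (hC _).1 hba.le, div_le_div_of_nonneg_right (hC _).2 hba.le⟩

end RampCutoff

/-! ### §3 The cone pacing -/

/-- **The radius pacing of cone-ification** `conePacing a b r₁ t = r₁ + rampCutoff a b t · (t − r₁)`:
`≡ r₁` for `t ≤ a`, `= t` for `t ≥ b`, a convex combination of `r₁` and `t` in between.
[folklore] -/
def conePacing (a b r₁ t : ℝ) : ℝ :=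
  r₁ + rampCutoff a b t * (t - r₁)

section ConePacing

variable {a b r₁ : ℝ}

/-- Below `a` the pacing is the constant `r₁`. [folklore] -/
theorem conePacing_of_le (hab : a < b) {t : ℝ} (ht : t ≤ a) : conePacing a b r₁ t = r₁ := by
  rw [conePacing, rampCutoff_of_le hab ht, zero_mul, add_zero]

/-- Above `b` the pacing is the identity. [folklore] -/
theorem conePacing_of_ge (hab : a < b) {t : ℝ} (ht : b ≤ t) : conePacing a b r₁ t = t := by
  rw [conePacing, rampCutoff_of_ge hab ht, one_mul, add_sub_cancel]

/-- The pacing is smooth. [folklore] -/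
theorem contDiff_conePacing (a b r₁ : ℝ) : ContDiff ℝ ∞ (conePacing a b r₁) :=
  contDiff_const.add ((contDiff_rampCutoff a b).mul (contDiff_id.sub contDiff_const))

/-- **The pacing lies between `r₁` and `t`** (for `r₁ ≤ t`): `r₁ ≤ conePacing a b r₁ t ≤ t`.
[folklore] -/
theorem conePacing_mem_Icc {t : ℝ} (ht : r₁ ≤ t) : conePacing a b r₁ t ∈ Icc r₁ t := by
  have hp := rampCutoff_mem_Icc a b t
  constructor
  · rw [conePacing]; nlinarith [hp.1]
  · rw [conePacing]; nlinarith [hp.2]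

/-- The pacing is positive on `t ≥ r₁ > 0`. [folklore] -/
theorem conePacing_pos (hr : 0 < r₁) {t : ℝ} (ht : r₁ ≤ t) : 0 < conePacing a b r₁ t :=
  lt_of_lt_of_le hr (conePacing_mem_Icc ht).1

/-- Derivative of the pacing: `μ' = rampCutoff' · (t − r₁) + rampCutoff`. [folklore] -/
theorem hasDerivAt_conePacing (t : ℝ) :
    HasDerivAt (conePacing a b r₁)
      (deriv (rampCutoff a b) t * (t - r₁) + rampCutoff a b t) t := by
  have hp : HasDerivAt (rampCutoff a b) (deriv (rampCutoff a b) t) t :=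
    (hasDerivAt_rampCutoff (a := a) (b := b) t).differentiableAt.hasDerivAt
  have h1 : HasDerivAt (fun s : ℝ => rampCutoff a b s * (s - r₁))
      (deriv (rampCutoff a b) t * (t - r₁) + rampCutoff a b t * 1) t :=
    hp.mul ((hasDerivAt_id t).sub_const r₁)
  rw [mul_one] at h1
  exact h1.const_add r₁

/-- **Bounded exponent of the cone pacing.** For `0 < r₁ ≤ a < b` and `r₁ ≤ t ≤ b`:
`|1 − t μ'(t)/μ(t)| ≤ 1 + b (C b/(b − a) + 1)/r₁` with the universal `C` of
`exists_deriv_smoothTransition_bound` (and for `t ≥ b` the exponent is `1`, for `t ≤ a` it is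
`0`). This is the hypothesis `hκ` of `injective_fderiv_coneifyStageMap` with an a-priori `K₀`.
[folklore] -/
theorem abs_one_sub_exponent_conePacing_le (hr : 0 < r₁) (hra : r₁ ≤ a) (hab : a < b) :
    ∃ K₀ : ℝ, 1 ≤ K₀ ∧ ∀ t : ℝ, r₁ ≤ t → t ≤ b →
      |1 - t * deriv (conePacing a b r₁) t / conePacing a b r₁ t| ≤ K₀ := by
  obtain ⟨C, hC0, hC⟩ := exists_deriv_rampCutoff_bound hab
  have hba : 0 < b - a := by linarith
  refine ⟨1 + b * (C / (b - a) * b + 1) / r₁, ?_, fun t ht htb => ?_⟩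
  · have : 0 ≤ b * (C / (b - a) * b + 1) / r₁ := by
      apply div_nonneg _ hr.le
      apply mul_nonneg (by linarith)
      have := div_nonneg hC0 hba.le
      nlinarith
    linarith
  set μ := conePacing a b r₁ t with hμ
  have hμpos : 0 < μ := conePacing_pos hr ht
  have hμr : r₁ ≤ μ := (conePacing_mem_Icc ht).1
  rw [(hasDerivAt_conePacing t).deriv]
  set d := deriv (rampCutoff a b) t with hd
  have hd0 : 0 ≤ d := (hC t).1
  have hdC : d ≤ C / (b - a) := (hC t).2
  have hpl := rampCutoff_mem_Icc a b t
  have ht0 : 0 ≤ t := hr.le.trans ht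
  -- `|t μ'/μ| ≤ b (C b/(b−a) + 1)/r₁`
  have hnum : |t * (d * (t - r₁) + rampCutoff a b t)| ≤ b * (C / (b - a) * b + 1) := by
    rw [abs_mul, abs_of_nonneg ht0]
    have h1 : |d * (t - r₁) + rampCutoff a b t| ≤ C / (b - a) * b + 1 := by
      rw [abs_le]; constructor
      · nlinarith [hpl.1, mul_nonneg hd0 (sub_nonneg.2 ht)]
      · have : d * (t - r₁) ≤ C / (b - a) * b := by
          calc d * (t - r₁) ≤ C / (b - a) * (t - r₁) := mul_le_mul_of_nonneg_right hdC (sub_nonneg.2 ht)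
            _ ≤ C / (b - a) * b := mul_le_mul_of_nonneg_left (by linarith) (div_nonneg hC0 hba.le)
        linarith [hpl.2]
    exact mul_le_mul htb h1 (abs_nonneg _) (by linarith)
  have hquot : |t * (d * (t - r₁) + rampCutoff a b t) / μ| ≤ b * (C / (b - a) * b + 1) / r₁ := by
    rw [abs_div, abs_of_pos hμpos]
    calc |t * (d * (t - r₁) + rampCutoff a b t)| / μ ≤ b * (C / (b - a) * b + 1) / μ :=
          div_le_div_of_nonneg_right hnum hμpos.le
      _ ≤ b * (C / (b - a) * b + 1) / r₁ := by
          apply div_le_div_of_nonneg_left _ hr hμr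
          apply mul_nonneg (by linarith)
          have := div_nonneg hC0 hba.le
          nlinarith
  calc |1 - t * (d * (t - r₁) + rampCutoff a b t) / μ|
      ≤ |(1 : ℝ)| + |t * (d * (t - r₁) + rampCutoff a b t) / μ| := abs_sub _ _
    _ ≤ 1 + b * (C / (b - a) * b + 1) / r₁ := by rw [abs_one]; linarith

end ConePacing

/-! ### §4 From the Euler defect to radial transversality -/

section Transversal

variable {F : Type*} [NormedAddCommGroup F] [InnerProductSpace ℝ F]

/-- **A source-form Euler defect smaller than the radius forces radial transversality.** Let
`L : F →ₗ[ℝ] F` (the fibre derivative of the normal part at a point `z ≠ 0` of the fibre) and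
`Nz : F` (its value) satisfy: every `u` with `L u = L z − Nz` has `‖u‖ < ‖z‖`. Then every `v` with
`L v = Nz` has `⟪v, z⟫ > 0`: indeed `u = z − v` solves `L u = L z − Nz`, so `‖z − v‖ < ‖z‖`, and
`⟪v, z⟫ = ‖z‖² − ⟪z − v, z⟫ ≥ ‖z‖ (‖z‖ − ‖z − v‖) > 0`.  This turns the pointwise export of
cone-ification (`TubeConeify.lean`) into the transversality hypothesis of `TubeLink.lean` and
`TubeRound.lean`. [folklore] -/
theorem inner_pos_of_euler_defect_lt {L : F →ₗ[ℝ] F} {z Nz : F} (hz : z ≠ 0)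
    (hdef : ∀ u : F, L u = L z - Nz → ‖u‖ < ‖z‖) {v : F} (hv : L v = Nz) : 0 < ⟪v, z⟫ := by
  have hu : L (z - v) = L z - Nz := by rw [map_sub, hv]
  have hlt := hdef _ hu
  have hzpos : 0 < ‖z‖ := norm_pos_iff.2 hz
  have h1 : ⟪v, z⟫ = ‖z‖ ^ 2 - ⟪z - v, z⟫ := by
    rw [inner_sub_left, real_inner_self_eq_norm_sq]; ring
  have h2 : ⟪z - v, z⟫ ≤ ‖z - v‖ * ‖z‖ := real_inner_le_norm _ _
  have h3 : ‖z - v‖ * ‖z‖ < ‖z‖ * ‖z‖ := mul_lt_mul_of_pos_right hlt hzpos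
  rw [h1]; nlinarith

/-- The same with a margin factor `K₀ ≥ 1` in the defect hypothesis (the form exported by
`injective_fderiv_coneifyStageMap`). [folklore] -/
theorem inner_pos_of_euler_defect_lt' {L : F →ₗ[ℝ] F} {z Nz : F} (hz : z ≠ 0) {K₀ : ℝ} (hK₀ : 1 ≤ K₀)
    (hdef : ∀ u : F, L u = L z - Nz → K₀ * ‖u‖ < ‖z‖) {v : F} (hv : L v = Nz) : 0 < ⟪v, z⟫ := by
  refine inner_pos_of_euler_defect_lt hz (fun u hu => ?_) hv
  have := hdef u hu
  have hu0 : ‖u‖ ≤ K₀ * ‖u‖ := by nlinarith [norm_nonneg u]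
  exact lt_of_le_of_lt hu0 this

end Transversal

end Literature.Topology.FourManifolds
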